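import Mathlib
import HarnessLib
import Summits.Ventures.LatticeQCDFlow.Exactness.SphereLuscherSeriesExistence

/-!
# Locality bookkeeping on `E^Λ`: functionals depending on a set of sites, stable under the site operators and the carré du champ

HONEST FRAMING: exact (Metropolis-corrected) sampling algorithms for lattice gauge theory;
figures of merit are autocorrelation/cost numbers at stated couplings and volumes; no
continuum-physics claim.

Venture `LatticeQCDFlow` (cell pub-lqcd), topic `Exactness`; FANOUT row 7 (`s0-cpn-null`).  NEW
WORK of the cell over Mathlib (`DependsOn`) and the tree's `Exactness/LatticeSitePolynomials.lean`,
`Exactness/LatticeSiteDerivatives.lean`, `Exactness/LatticeSitePolynomialLaplacian.lean`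
(`polyS`, `siteDeriv`, `siteEuler`, `ambSiteLap`, `polyS_siteLaplacian_stable`) and
`Exactness/SphereLuscherSeriesExistence.lean` (`ambCarre`); nothing is cited as a fact.
Sphere-model counterpart of theory-1's `TrivializingMaps/LinkPolynomials.lean` §3–§4 (`depOn`,
`PD m A`).  Printed counterpart, NAMED ONLY: M. Lüscher, Commun. Math. Phys. 293 (2010) 899, §4.4–4.5
(the order-`k` flow action is a sum of local terms whose footprint grows linearly with `k`);
Engel–Schaefer, Comput. Phys. Commun. 182 (2011) 2107, §3.

## Content (`E` finite-dimensional real inner product space; `Λ` finite; `A ⊆ Λ`)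

* `sdepOn A` — the functionals on `Λ → E` depending only on the sites in `A` (a submodule; products,
  constants, coordinates of sites in `A`).
* **`siteDeriv_eq_zero_of_not_mem`** / **`siteDeriv_mem_sdepOn`** — `D_k F = 0` for `k ∉ A` and
  `D_k F ∈ sdepOn A`, for `F ∈ sdepOn A`; likewise `siteEuler`, `siteFlatLap`, `ambSiteLap`
  (`ambSiteLap_eq_zero_of_not_mem`, `ambSiteLap_mem_sdepOn`): E–S's site operators neither create
  dependence on new sites nor see sites the functional ignores.
* `polySD N A = polyS N ⊓ sdepOn A` — lattice polynomials of degree `≤ N` supported in `A`: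
  finite-dimensional, containing the constants, `C²`, and **`polySD_siteLaplacian_stable`** — stable
  under `Σ_k ∂̃_k·∂̃_k` on the product of unit spheres (the LOCAL polynomial instance of the Poisson
  solver `SphereLatticePoissonSolver.exists_luscher_poisson_solution`).
* **`ambCarre_eq_zero_of_not_mem`**, **`ambCarre_mem_sdepOn`** — the carré du champ
  `ambCarre k S X` vanishes for `k` outside the support of `X` and is supported in any set carrying
  both `∂_k S`, `E_k S` and `X`.

NOT CLAIMED: anything about measures; the local recursion itself (sequel
`Exactness/SphereLuscherSeriesLocality.lean`); anything quantitative.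
-/

noncomputable section

namespace Summit.Ventures.LatticeQCDFlow.Exactness

open Function Set NormedSpace InnerProductSpace Metric
open scoped RealInnerProductSpace ContDiff

variable {Λ : Type*} {E : Type*} [NormedAddCommGroup E] [InnerProductSpace ℝ E]

/-! ## §1 Functionals depending on a set of sites -/

section DepOn

/-- **`sdepOn A`**: the functionals on `Λ → E` depending only on the sites in `A`. -/
def sdepOn (A : Set Λ) : Submodule ℝ ((Λ → E) → ℝ) where
  carrier := {F | DependsOn F A}
  add_mem' {F G} hF hG := fun x x' h => by
    show F x + G x = F x' + G x'
    rw [hF h, hG h]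
  zero_mem' := fun _ _ _ => rfl
  smul_mem' c {F} hF := fun x x' h => by
    show c • F x = c • F x'
    rw [hF h]

omit [NormedAddCommGroup E] [InnerProductSpace ℝ E] in
/-- Membership in `sdepOn A` is `DependsOn · A`. -/
theorem mem_sdepOn {A : Set Λ} {F : (Λ → E) → ℝ} : F ∈ sdepOn A ↔ DependsOn F A := Iff.rfl

omit [NormedAddCommGroup E] [InnerProductSpace ℝ E] in
/-- `sdepOn` is monotone in the site set. -/
theorem sdepOn_mono {A A' : Set Λ} (h : A ⊆ A') : sdepOn (E := E) A ≤ sdepOn A' :=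
  fun _ hF _ _ hx => hF fun i hi => hx i (h hi)

omit [NormedAddCommGroup E] [InnerProductSpace ℝ E] in
/-- Constants depend on no site. -/
theorem const_mem_sdepOn (A : Set Λ) (c : ℝ) : (fun _ : Λ → E => c) ∈ sdepOn A :=
  fun _ _ _ => rfl

omit [NormedAddCommGroup E] [InnerProductSpace ℝ E] in
/-- `sdepOn A` is closed under products. -/
theorem mul_mem_sdepOn {A : Set Λ} {F G : (Λ → E) → ℝ} (hF : F ∈ sdepOn A) (hG : G ∈ sdepOn A) :
    F * G ∈ sdepOn A := fun x x' hx => by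
  show F x * G x = F x' * G x'
  rw [hF hx, hG hx]

/-- A linear site functional of a site in `A` depends only on `A`. -/
theorem slin_mem_sdepOn {A : Set Λ} {n : Λ} (h : n ∈ A) (w : E) :
    (fun x : Λ → E => ⟪w, x n⟫) ∈ sdepOn A := fun x x' hx => by
  simp only [hx n h]

variable [FiniteDimensional ℝ E]

/-- A site coordinate of a site in `A` depends only on `A`. -/
theorem scoord_mem_sdepOn {A : Set Λ} {κ : SiteCoord Λ E} (h : κ.1 ∈ A) : scoord κ ∈ sdepOn A :=
  fun x x' hx => by simp only [scoord, hx _ h]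

end DepOn

/-! ## §2 The site operators respect the dependence set -/

section Operators

variable [DecidableEq Λ]

omit [NormedAddCommGroup E] [InnerProductSpace ℝ E] in
/-- Two configurations agreeing on `A` have equal site sections of an `A`-supported functional. -/
theorem section_eq_of_sdepOn {A : Set Λ} {F : (Λ → E) → ℝ} (hF : DependsOn F A) {x x' : Λ → E}
    (hx : ∀ n ∈ A, x n = x' n) (k : Λ) :
    (fun y => F (update x k y)) = fun y => F (update x' k y) := by
  funext y
  apply hF
  intro i hi
  by_cases hik : i = k
  · subst hik; simp
  · simp [update_of_ne hik, hx i hi]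

omit [NormedAddCommGroup E] [InnerProductSpace ℝ E] in
/-- The site section at a site OUTSIDE the support is constant. -/
theorem section_eq_const_of_not_mem {A : Set Λ} {F : (Λ → E) → ℝ} (hF : DependsOn F A) {k : Λ}
    (hk : k ∉ A) (x : Λ → E) : (fun y => F (update x k y)) = fun _ => F x := by
  funext y
  apply hF
  intro i hi
  rw [update_of_ne (ne_of_mem_of_not_mem hi hk)]

/-- **`D_k F = 0` for `k` outside the support of `F`.** -/
theorem siteDeriv_eq_zero_of_not_mem {A : Set Λ} {F : (Λ → E) → ℝ} (hF : F ∈ sdepOn A) {k : Λ}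
    (hk : k ∉ A) (v : E) : siteDeriv k v F = 0 := by
  funext x
  simp only [siteDeriv, section_eq_const_of_not_mem hF hk x, fderiv_fun_const, Pi.zero_apply,
    zero_apply]

/-- **`D_k F ∈ sdepOn A` for `F ∈ sdepOn A`.** -/
theorem siteDeriv_mem_sdepOn {A : Set Λ} {F : (Λ → E) → ℝ} (hF : F ∈ sdepOn A) (k : Λ) (v : E) :
    siteDeriv k v F ∈ sdepOn A := by
  by_cases hk : k ∈ A
  · intro x x' hx
    simp only [siteDeriv, section_eq_of_sdepOn hF hx k, hx k hk]
  · rw [siteDeriv_eq_zero_of_not_mem hF hk]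
    exact Submodule.zero_mem _

/-- `E_k F = 0` for `k` outside the support of `F`. -/
theorem siteEuler_eq_zero_of_not_mem {A : Set Λ} {F : (Λ → E) → ℝ} (hF : F ∈ sdepOn A) {k : Λ}
    (hk : k ∉ A) : siteEuler k F = 0 := by
  funext x
  show siteDeriv k (x k) F x = 0
  rw [siteDeriv_eq_zero_of_not_mem hF hk]
  rfl

/-- `E_k F ∈ sdepOn A` for `F ∈ sdepOn A`. -/
theorem siteEuler_mem_sdepOn {A : Set Λ} {F : (Λ → E) → ℝ} (hF : F ∈ sdepOn A) (k : Λ) :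
    siteEuler k F ∈ sdepOn A := by
  by_cases hk : k ∈ A
  · intro x x' hx
    simp only [siteEuler, siteDeriv, section_eq_of_sdepOn hF hx k, hx k hk]
  · rw [siteEuler_eq_zero_of_not_mem hF hk]
    exact Submodule.zero_mem _

variable [FiniteDimensional ℝ E]

/-- The flat site Laplacian respects the support, and vanishes outside it. -/
theorem siteFlatLap_mem_sdepOn {A : Set Λ} {F : (Λ → E) → ℝ} (hF : F ∈ sdepOn A) (k : Λ) :
    siteFlatLap k F ∈ sdepOn A := by
  have e : siteFlatLap k F = ∑ i, siteDeriv k (stdOrthonormalBasis ℝ E i)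
      (siteDeriv k (stdOrthonormalBasis ℝ E i) F) := by
    funext x; simp only [siteFlatLap, Finset.sum_apply]
  rw [e]
  exact Submodule.sum_mem _ fun i _ => siteDeriv_mem_sdepOn (siteDeriv_mem_sdepOn hF k _) k _

/-- **`ambSiteLap k F ∈ sdepOn A` for `F ∈ sdepOn A`.** -/
theorem ambSiteLap_mem_sdepOn {A : Set Λ} {F : (Λ → E) → ℝ} (hF : F ∈ sdepOn A) (k : Λ) :
    ambSiteLap k F ∈ sdepOn A := by
  have e : ambSiteLap k F = siteFlatLap k F - siteEuler k (siteEuler k F) -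
      ((Module.finrank ℝ E : ℝ) - 2) • siteEuler k F := by
    funext x; simp only [ambSiteLap, Pi.sub_apply, Pi.smul_apply, smul_eq_mul]
  rw [e]
  exact Submodule.sub_mem _ (Submodule.sub_mem _ (siteFlatLap_mem_sdepOn hF k)
    (siteEuler_mem_sdepOn (siteEuler_mem_sdepOn hF k) k))
    (Submodule.smul_mem _ _ (siteEuler_mem_sdepOn hF k))

/-- **`ambSiteLap k F = 0` for `k` outside the support of `F`.** -/
theorem ambSiteLap_eq_zero_of_not_mem {A : Set Λ} {F : (Λ → E) → ℝ} (hF : F ∈ sdepOn A) {k : Λ}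
    (hk : k ∉ A) : ambSiteLap k F = 0 := by
  funext x
  simp only [ambSiteLap, siteFlatLap, siteEuler_eq_zero_of_not_mem hF hk,
    siteDeriv_eq_zero_of_not_mem hF hk, siteDeriv_zero, siteEuler_zero, Pi.zero_apply,
    Finset.sum_const_zero, mul_zero, sub_zero]

/-- `Σ_k ambSiteLap k F ∈ sdepOn A` for `F ∈ sdepOn A`. -/
theorem sum_ambSiteLap_mem_sdepOn [Fintype Λ] {A : Set Λ} {F : (Λ → E) → ℝ} (hF : F ∈ sdepOn A) :
    (fun x => ∑ k, ambSiteLap k F x) ∈ sdepOn A := by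
  have e : (fun x => ∑ k, ambSiteLap k F x) = ∑ k, ambSiteLap k F := by
    funext x; simp only [Finset.sum_apply]
  rw [e]
  exact Submodule.sum_mem _ fun k _ => ambSiteLap_mem_sdepOn hF k

end Operators

/-! ## §3 The local polynomial spaces `polySD N A` and the local Poisson solver's hypotheses -/

section LocalSpaces

variable [FiniteDimensional ℝ E] [Fintype Λ] [DecidableEq Λ]

variable (Λ E) in
/-- **`polySD Λ E N A`**: lattice polynomials of degree `≤ N` depending only on the sites in `A`. -/
def polySD (N : ℕ) (A : Set Λ) : Submodule ℝ ((Λ → E) → ℝ) := polyS Λ E N ⊓ sdepOn A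

omit [Fintype Λ] [DecidableEq Λ] in
/-- Membership in `polySD N A`. -/
theorem mem_polySD {N : ℕ} {A : Set Λ} {F : (Λ → E) → ℝ} :
    F ∈ polySD Λ E N A ↔ F ∈ polyS Λ E N ∧ F ∈ sdepOn A := Iff.rfl

/-- `polySD N A` is finite-dimensional. -/
instance polySD.finiteDimensional (N : ℕ) (A : Set Λ) : FiniteDimensional ℝ (polySD Λ E N A) :=
  Submodule.finiteDimensional_inf_left _ _

omit [Fintype Λ] [DecidableEq Λ] in
/-- `polySD` is monotone in degree and support. -/
theorem polySD_mono {N N' : ℕ} {A A' : Set Λ} (hN : N ≤ N') (hA : A ⊆ A') :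
    polySD Λ E N A ≤ polySD Λ E N' A' :=
  inf_le_inf (polyS_mono hN) (sdepOn_mono hA)

omit [Fintype Λ] [DecidableEq Λ] in
/-- Constants lie in every `polySD N A`. -/
theorem const_mem_polySD (N : ℕ) (A : Set Λ) (c : ℝ) : (fun _ : Λ → E => c) ∈ polySD Λ E N A :=
  ⟨const_mem_polyS N c, const_mem_sdepOn A c⟩

omit [Fintype Λ] [DecidableEq Λ] in
/-- Degree- and support-bounded products. -/
theorem mul_mem_polySD {a b N : ℕ} (h : a + b ≤ N) {A : Set Λ} {F G : (Λ → E) → ℝ}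
    (hF : F ∈ polySD Λ E a A) (hG : G ∈ polySD Λ E b A) : F * G ∈ polySD Λ E N A :=
  ⟨mul_mem_polyS_of_le h hF.1 hG.1, mul_mem_sdepOn hF.2 hG.2⟩

omit [DecidableEq Λ] in
/-- Members of `polySD N A` are `C²`. -/
theorem polySD_contDiff_two (N : ℕ) (A : Set Λ) : ∀ f ∈ polySD Λ E N A, ContDiff ℝ 2 f :=
  fun _ hf => contDiff_infty.1 (contDiff_of_mem_polyS hf.1) 2

/-- **THE LOCAL POLYNOMIAL INSTANCE OF THE POISSON SOLVER'S STABILITY HYPOTHESIS**: for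
`f ∈ polySD N A`, `Σ_k ∂̃_k·∂̃_k f` agrees on the product of unit spheres with the member
`Σ_k ambSiteLap k f` of `polySD N A`. -/
theorem polySD_siteLaplacian_stable (N : ℕ) (A : Set Λ) :
    ∀ f ∈ polySD Λ E N A, ∃ g ∈ polySD Λ E N A, ∀ ξ : Λ → sphere (0 : E) 1,
      ∑ k, siteLaplacian k f (fun n => (ξ n : E)) = g (fun n => (ξ n : E)) := by
  intro f hf
  refine ⟨fun x => ∑ k, ambSiteLap k f x, ⟨sum_ambSiteLap_mem_polyS hf.1,
    sum_ambSiteLap_mem_sdepOn hf.2⟩, fun ξ => ?_⟩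
  exact sum_siteLaplacian_eq_sum_ambSiteLap (contDiff_of_mem_polyS hf.1) fun k => by simp

end LocalSpaces

/-! ## §4 The carré du champ respects supports -/

section CarreLocal

variable [FiniteDimensional ℝ E] [DecidableEq Λ]

/-- **`ambCarre k S X = 0` for `k` outside the support of `X`.** -/
theorem ambCarre_eq_zero_of_not_mem {B : Set Λ} {S X : (Λ → E) → ℝ} (hX : X ∈ sdepOn B) {k : Λ}
    (hk : k ∉ B) : ambCarre k S X = 0 := by
  funext x
  simp only [ambCarre, siteDeriv_eq_zero_of_not_mem hX hk, siteEuler_eq_zero_of_not_mem hX hk,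
    Pi.zero_apply, mul_zero, Finset.sum_const_zero, sub_zero]

/-- **Support of the carré du champ**: if `D_k S · b_i`, `E_k S` and `X` are all supported in `C`,
so is `ambCarre k S X`. -/
theorem ambCarre_mem_sdepOn {C : Set Λ} {S X : (Λ → E) → ℝ} {k : Λ}
    (hdS : ∀ i, siteDeriv k (stdOrthonormalBasis ℝ E i) S ∈ sdepOn C)
    (heS : siteEuler k S ∈ sdepOn C) (hX : X ∈ sdepOn C) : ambCarre k S X ∈ sdepOn C := by
  have e : ambCarre k S X = (∑ i, siteDeriv k (stdOrthonormalBasis ℝ E i) S *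
      siteDeriv k (stdOrthonormalBasis ℝ E i) X) - siteEuler k S * siteEuler k X := by
    funext x; simp only [ambCarre, Pi.sub_apply, Finset.sum_apply, Pi.mul_apply]
  rw [e]
  exact Submodule.sub_mem _ (Submodule.sum_mem _ fun i _ =>
    mul_mem_sdepOn (hdS i) (siteDeriv_mem_sdepOn hX k _)) (mul_mem_sdepOn heS (siteEuler_mem_sdepOn hX k))

/-- For a functional supported in `A`, its site derivatives and Euler terms at ANY site are supported
in `A` (so the hypotheses of `ambCarre_mem_sdepOn` hold with `C ⊇ A`). -/
theorem siteDeriv_siteEuler_mem_sdepOn_of_subset {A C : Set Λ} (hAC : A ⊆ C) {S : (Λ → E) → ℝ}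
    (hS : S ∈ sdepOn A) (k : Λ) :
    (∀ i, siteDeriv k (stdOrthonormalBasis ℝ E i) S ∈ sdepOn C) ∧ siteEuler k S ∈ sdepOn C :=
  ⟨fun i => sdepOn_mono hAC (siteDeriv_mem_sdepOn hS k (stdOrthonormalBasis ℝ E i)),
    sdepOn_mono hAC (siteEuler_mem_sdepOn hS k)⟩

end CarreLocal

end Summit.Ventures.LatticeQCDFlow.Exactness

end
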